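import Summits.QuantumFields.YangMills.Theorems.BalabanUVNodesN15KingModelFreeLatticeKernel
import Summits.QuantumFields.YangMills.Theorems.BalabanUVNodesN15KingModelGriffithsFiniteEtaStrict
import HarnessLib

/-!
# BalabanUVNodes ∕ N15 — THE KING-MODEL RUNG (PART Ε-b): KING's TORUS COVARIANCE IS THE PERIODISATION OF THE FREE LATTICE KERNEL —
# `(lapF K c m²)⁻¹(x, y) = (Π_μK_μ)⁻¹ Σ_{k ∈ Π_μℤ∕K_μ} e^{ip′_k·(x̃−ỹ)}∕(m² + cΣ_μ(2−2cos p′_{k,μ})) = Σ_{m ∈ ℤ^{d+1}} K_∞(x̃ − ỹ + (K_μm_μ)_μ)` (EVERY period vector, `c ≥ 0`, `m² > 0`)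
# (Track A, DAG node N15 = NE2; FAN-OUT v1.1 §N15 s3 «KING-MODEL RUNG»; the torus∕infinite-lattice dictionary behind King p.670's transport; count-neutral)

HONEST FRAMING.  Count-neutral (cell `pub-ymgap`, seat `pub-ymgap-dag-n15-e` g40; `--supports stmt-QuantumFields-27366 --as helper` = K3⁸).
TEMPLATE LITERATURE: C. King, Commun. Math. Phys. **102** (1986) 649–677 [King1986], (4.4) p.670 (the symbol `Δ^η(p) + m²`), (4.1) p.670 (plane waves on the
torus), §4 p.670 l.8–13 (the Ω-propagators «can be written in terms of the operator defined by (2.13) with free boundary conditions (and A = 0, of course) …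
Such representations are given explicitly in [Ba 4]»); T. Bałaban, Commun. Math. Phys. **95** (1984) 17–40 [Balaban1984PropagatorsI], p.23 (1.29) (the dual
torus `p_μ = (π∕L′_μ)n_μ, −L′_μ ≤ n_μ < L′_μ` and the finite Fourier inversion), p.36 l.20–23 («relating G on the torus to G on the whole lattice ηZ^d in the usual
way»); [Ba 4] = [Balaban1983RegularityDecay] (2.43) p.584.  THIS FILE proves «the usual way» FOR KING's TORUS COVARIANCE `(lapF K c m²)⁻¹` — the object on
which this whole lineage (parts Ψ…Ν) carries King's `A = 0` kernels — with the cell's Poisson-summation engine `B4TorusKernel` (pv17,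
`MultiPeriod.torusKernel_descend_eq`: dual-grid sum of a strip-regular multiplier = periodised lattice kernel) and part Ε-a's free kernel `K_∞`:
§1 the DUAL-GRID KERNEL `torusFreeKerC c m² N w = (Π_μN_μ)⁻¹Σ_k freeMultC(p′_k)·Π_μe^{2πi k_μw_μ∕N_μ}` (B5 (1.29); `p′_k = B4TorusGreen244.dualMomentum N k ∈ [−π,π)^{d+1}`),
`torusFreeKerC_eq_torusKernel` (it IS the engine's `MultiPeriod.torusKernel` of the descended multiplier, `rfl`), ★★★ **`torusFreeKerC_eq_periodise`**
(`= Σ'_{m∈ℤ^{d+1}} K_∞(w + (N_μm_μ)_μ)`, absolutely convergent by Ε-a's decay), `torusFreeKerC_translate` (N-periodic), `torusFreeKerC_congr`; §2 ★★ **`torusFreeKerC_green`**: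
THE STENCIL EQUATION `m²T(w) + cΣ_μ(2T(w) − T(w+e_μ) − T(w−e_μ)) = 1[N_μ ∣ w_μ ∀μ]` on `ℤ^{d+1}` — a FINITE computation (plane waves are eigenfunctions of the stencil
with eigenvalue the symbol; multiplier × symbol = 1 at the real dual momenta; the character sum `B4TorusKernel.MultiPeriod.sum_mFourier_grid`); §3 the passage
to King's torus `Tor K = Π_μℤ∕K_μ`: `torRepZ x = (val x_μ)_μ ∈ ℤ^{d+1}`, congruences of `torRepZ (x ± e_μ)`, `dvd_torRepZ_sub_iff`; the column equation
`(lapF K c m²) · T(torRepZ · − torRepZ y) = δ_y` (real and imaginary parts), hence by invertibility of `lapF` (`isUnit_lapF`, part Ϻ): ★★★ **`lapF_inv_eq_torusFreeKerC`**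
(`((lapF K c m²)⁻¹ x y : ℂ) = torusFreeKerC c m² K (torRepZ x − torRepZ y)` — KING's (4.1)∕(4.4) PLANE-WAVE FORM OF THE TORUS COVARIANCE in B5's dual-grid variables) and
★★★ **`lapF_inv_eq_periodise`** ∕ ★★★ **`lapF_inv_eq_tsum_freeKer`** (`(lapF K c m²)⁻¹ x y = Σ_{m∈ℤ^{d+1}} K_∞(torRepZ x − torRepZ y + (K_μm_μ)_μ)`, complex and real forms):
King's torus covariance IS the periodisation of the free infinite-lattice kernel — every period vector `K` (all `K_μ ≥ 1`), every `c ≥ 0`, `m² > 0`, every `d`.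
§4 corollary ★★ **`tsum_freeKer_eq_inv_mass`**: `Σ_{z∈ℤ^{d+1}} K_∞(z) = 1∕m²` (the one-point torus `K = 1`, where `c(−Δ) = 0` and `(lapF)⁻¹ = 1∕m²`).

PRIOR TREE ART (used, not restated): pv17 `B4TorusKernel` (periodisation∕Poisson engine, hypothesis = a strip-regular multiplier — supplied by Ε-a), b04
`B4Torus248Decay.torusKernel248_eq_periodise` ∕ `B4TorusGreen244.torusGreen244` (the SAME two steps for [Ba 4]'s (2.48) kernel `G_jQ_j^*` with `a > 0` — the `a ≠ 0`
analogue; there the torus operator is the stencil on periodic functions, here it is King's MATRIX `lapF` and the identification is with its matrix inverse).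
NOT Bałaban's covariant objects; NOT a node discharge (N15 is booked through n15-a's knit, untouched); nothing continuum-YM ∕ `ℝ⁴` ∕ OS ∕ Clay.  0 `sorry`;
3 `def` (`torusFreeKerC`, `dualTerm`, `torRepZ`).

HONEST SCOPE.  Identities (finite Fourier analysis on `Π_μℤ∕K_μ` + the engine's Poisson summation); the only estimate used is Ε-a's decay (absolute convergence).
WHAT THE CURVED CASE ADDS: nothing of this survives at `U ≠ 1` (no translation invariance ⇒ no multiplier, no periodisation); at `A = 0` with the block term
`aQ^*Q` (King's `G_k`, [Ba 4]'s `G_j`) the analogue is the tree's `torusKernel248_eq_periodise`.  Locators: [King1986] (4.1), (4.4) p.670, §4 p.670 l.8–13, (2.13)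
p.653; [Balaban1984PropagatorsI] (1.29) p.23, p.36 l.20–23; [Balaban1983RegularityDecay] (2.43) p.584.
-/

noncomputable section

open scoped BigOperators ComplexConjugate
open Finset Complex Matrix

namespace Summit.QuantumFields.YangMills.BalabanUVNodes.N15KingModelRung.TorusSpectral

open Literature.MathematicalPhysics.QuantumFieldTheory.Balaban1983to89.B5Prop11Plancherel (Tor unitVec)
open Literature.MathematicalPhysics.QuantumFieldTheory.Balaban1983to89.B4Strip (S1 ofRealVec)
open Literature.MathematicalPhysics.QuantumFieldTheory.Balaban1983to89.B4ContourShift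
open Literature.MathematicalPhysics.QuantumFieldTheory.Balaban1983to89.B4Green244 (e phaseC two_sub_exp)
open Literature.MathematicalPhysics.QuantumFieldTheory.Balaban1983to89.B4TorusKernel (rep descendC)
open Literature.MathematicalPhysics.QuantumFieldTheory.Balaban1983to89.B4TorusKernel.MultiPeriod (translate translate_apply gridPt sum_mFourier_grid
  mFourier_translate_gridPt torusKernel_descend_eq)
open Literature.MathematicalPhysics.QuantumFieldTheory.Balaban1983to89.B4TorusGreen244 (dualMomentum mFourier_gridPt phaseC_sub)
open Literature.MathematicalPhysics.QuantumFieldTheory.King1986.Torus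
open Summit.QuantumFields.YangMills.BalabanUVNodes.N15KingModelRung.ProperTime (isUnit_lapF lapF_mulVec_injective)

variable {d : ℕ}

/-! ## §1 The dual-grid kernel of B5 (1.29) and its identification with the periodised free kernel -/

section DualGrid

variable (c m2 : ℝ) (N : Fin (d + 1) → ℕ)

/-- KING's TORUS COVARIANCE IN PLANE WAVES (B5 (1.29) dual-grid form): `T_N(w) = (Π_μN_μ)⁻¹ Σ_{k ∈ Π_μℤ∕N_μ} e^{ip′_k·w}∕(m² + cΣ_μ(2 − 2cos p′_{k,μ}))`,
`p′_{k,μ} = 2π rep(k_μ∕N_μ) ∈ [−π,π)`, `w ∈ ℤ^{d+1}`. [cite: King1986, (4.1), (4.4) p.670; Balaban1984PropagatorsI, (1.29) p.23] -/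
def torusFreeKerC (w : Fin (d + 1) → ℤ) : ℂ :=
  (∏ i, ((N i : ℕ) : ℂ))⁻¹ * ∑ k : (i : Fin (d + 1)) → Fin (N i), freeMultC c m2 (ofRealVec (dualMomentum N k)) * UnitAddTorus.mFourier w (gridPt N k)

variable {c m2}

/-- The dual-grid kernel IS the engine's `MultiPeriod.torusKernel` of the descended free multiplier (definitional). [folklore] -/
theorem torusFreeKerC_eq_torusKernel (hc : 0 ≤ c) (hm : 0 < m2) (w : Fin (d + 1) → ℤ) :
    torusFreeKerC c m2 N w
      = Literature.MathematicalPhysics.QuantumFieldTheory.Balaban1983to89.B4TorusKernel.MultiPeriod.torusKernel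
          (descendC _ (stripRegular_freeMultC (d := d) hc hm) (kappaFree_pos hc hm d).le) N w := rfl

/-- ★★★ **«RELATING G ON THE TORUS TO G ON THE WHOLE LATTICE IN THE USUAL WAY»** for the free massive covariance: the dual-grid kernel is the
PERIODISATION of the infinite-lattice kernel, `T_N(w) = Σ_{m ∈ ℤ^{d+1}} K_∞(w + (N_μm_μ)_μ)`, for every `c ≥ 0`, `m² > 0`, all `N_μ ≥ 1`, every `w` (Poisson
summation; the series converges absolutely by Ε-a's decay). [cite: Balaban1984PropagatorsI, p.36 l.20–23, (1.29) p.23; Balaban1983RegularityDecay, (2.43) p.584; King1986, (4.4) p.670] -/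
theorem torusFreeKerC_eq_periodise (hc : 0 ≤ c) (hm : 0 < m2) (hN : ∀ i, 1 ≤ N i) (w : Fin (d + 1) → ℤ) :
    torusFreeKerC c m2 N w = ∑' m : Fin (d + 1) → ℤ, freeKerC c m2 (translate N w m) := by
  rw [torusFreeKerC_eq_torusKernel N hc hm w]
  exact torusKernel_descend_eq (stripRegular_freeMultC hc hm) (kappaFree_pos hc hm d) hN w

/-- PERIODICITY: `T_N(w + (N_μm_μ)_μ) = T_N(w)`. [folklore] -/
theorem torusFreeKerC_translate (hN : ∀ i, 1 ≤ N i) (w m : Fin (d + 1) → ℤ) :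
    torusFreeKerC c m2 N (translate N w m) = torusFreeKerC c m2 N w := by
  unfold torusFreeKerC
  congr 1
  exact Finset.sum_congr rfl fun k _ => by rw [mFourier_translate_gridPt hN w m k]

/-- `T_N` depends on `w` only through its class in `Π_μ ℤ∕N_μ`. [folklore] -/
theorem torusFreeKerC_congr (hN : ∀ i, 1 ≤ N i) {w w' : Fin (d + 1) → ℤ} (h : ∀ i, (N i : ℤ) ∣ w i - w' i) :
    torusFreeKerC c m2 N w = torusFreeKerC c m2 N w' := by
  have hw : w = translate N w' (fun i => (w i - w' i) / (N i : ℤ)) := by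
    funext i
    rw [translate_apply, Int.mul_ediv_cancel' (h i)]
    ring
  rw [hw, torusFreeKerC_translate N hN]

end DualGrid

/-! ## §2 The stencil equation for the dual-grid kernel (a finite computation) -/

section Green

variable {c m2 : ℝ} (N : Fin (d + 1) → ℕ)

/-- `p·(w + e_μ) = p·w + p_μ`. [folklore] -/
theorem phaseC_add_e (P : Fin (d + 1) → ℂ) (w : Fin (d + 1) → ℤ) (μ : Fin (d + 1)) : phaseC P (w + e μ) = phaseC P w + P μ := by
  rw [show w + e μ = w - (-e μ) by rw [sub_neg_eq_add], phaseC_sub, phaseC_neg_e, sub_neg_eq_add]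

/-- `p·(w − e_μ) = p·w − p_μ`. [folklore] -/
theorem phaseC_sub_e (P : Fin (d + 1) → ℂ) (w : Fin (d + 1) → ℤ) (μ : Fin (d + 1)) : phaseC P (w - e μ) = phaseC P w - P μ := by
  rw [phaseC_sub, phaseC_e]

/-- ONE PLANE WAVE: `e^{ip·w}` is an eigenfunction of the stencil with eigenvalue the symbol, and multiplier × symbol = 1:
`m²·G(p)e^{ip·w} + cΣ_μ(2G(p)e^{ip·w} − G(p)e^{ip·(w+e_μ)} − G(p)e^{ip·(w−e_μ)}) = e^{ip·w}` at every real momentum. [cite: King1986, (4.4) p.670] -/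
theorem planeWave_stencil (hc : 0 ≤ c) (hm : 0 < m2) (p : Fin (d + 1) → ℝ) (w : Fin (d + 1) → ℤ) :
    (m2 : ℂ) * (freeMultC c m2 (ofRealVec p) * cexp (I * phaseC (ofRealVec p) w))
        + (c : ℂ) * ∑ μ, (2 * (freeMultC c m2 (ofRealVec p) * cexp (I * phaseC (ofRealVec p) w))
            - freeMultC c m2 (ofRealVec p) * cexp (I * phaseC (ofRealVec p) (w + e μ))
            - freeMultC c m2 (ofRealVec p) * cexp (I * phaseC (ofRealVec p) (w - e μ)))
      = cexp (I * phaseC (ofRealVec p) w) := by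
  have hμ : ∀ μ, 2 * (freeMultC c m2 (ofRealVec p) * cexp (I * phaseC (ofRealVec p) w))
      - freeMultC c m2 (ofRealVec p) * cexp (I * phaseC (ofRealVec p) (w + e μ)) - freeMultC c m2 (ofRealVec p) * cexp (I * phaseC (ofRealVec p) (w - e μ))
      = freeMultC c m2 (ofRealVec p) * cexp (I * phaseC (ofRealVec p) w) * S1 (ofRealVec p μ) := by
    intro μ
    rw [phaseC_add_e, phaseC_sub_e, mul_add, mul_sub, Complex.exp_add, Complex.exp_sub, ← two_sub_exp (ofRealVec p μ), div_eq_mul_inv,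
      ← Complex.exp_neg]
    ring
  simp_rw [hμ]
  rw [← Finset.mul_sum]
  have key : ((m2 : ℂ) + (c : ℂ) * ∑ μ, S1 (ofRealVec p μ)) * freeMultC c m2 (ofRealVec p) = 1 :=
    mul_inv_cancel₀ (freeSymC_ofRealVec_ne_zero hc hm p)
  linear_combination cexp (I * phaseC (ofRealVec p) w) * key

/-- one dual-grid term `(Π_μN_μ)⁻¹·G(p′_k)·e^{ip′_k·x}` of `T_N`. [cite: Balaban1984PropagatorsI, (1.29) p.23] -/
def dualTerm (c m2 : ℝ) (N : Fin (d + 1) → ℕ) (k : (i : Fin (d + 1)) → Fin (N i)) (x : Fin (d + 1) → ℤ) : ℂ :=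
  (∏ i, ((N i : ℕ) : ℂ))⁻¹ * (freeMultC c m2 (ofRealVec (dualMomentum N k)) * cexp (I * phaseC (ofRealVec (dualMomentum N k)) x))

/-- `T_N = Σ_k dualTerm_k` (the grid character is the plane wave at the dual momentum). [folklore] -/
theorem torusFreeKerC_eq_sum_dualTerm (x : Fin (d + 1) → ℤ) : torusFreeKerC c m2 N x = ∑ k, dualTerm c m2 N k x := by
  unfold torusFreeKerC dualTerm
  rw [Finset.mul_sum]
  exact Finset.sum_congr rfl fun k _ => by rw [mFourier_gridPt]

/-- the stencil on one dual-grid term returns the bare character: `(Π_μN_μ)⁻¹·e^{ip′_k·w}`. [cite: King1986, (4.4) p.670] -/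
theorem dualTerm_stencil (hc : 0 ≤ c) (hm : 0 < m2) (k : (i : Fin (d + 1)) → Fin (N i)) (w : Fin (d + 1) → ℤ) :
    (m2 : ℂ) * dualTerm c m2 N k w + (c : ℂ) * ∑ μ, (2 * dualTerm c m2 N k w - dualTerm c m2 N k (w + e μ) - dualTerm c m2 N k (w - e μ))
      = (∏ i, ((N i : ℕ) : ℂ))⁻¹ * UnitAddTorus.mFourier w (gridPt N k) := by
  have pw := planeWave_stencil hc hm (dualMomentum N k) w
  rw [mFourier_gridPt]
  unfold dualTerm
  simp only [Finset.sum_sub_distrib, Finset.sum_const, Finset.card_univ, Fintype.card_fin, nsmul_eq_mul, ← Finset.mul_sum] at pw ⊢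
  linear_combination (∏ i, ((N i : ℕ) : ℂ))⁻¹ * pw

/-- rearrangement: the stencil of a finite superposition is the superposition of the stencils. [folklore] -/
theorem stencil_sum {ι : Type*} [Fintype ι] (g : ι → (Fin (d + 1) → ℤ) → ℂ) (A B : ℂ) (w : Fin (d + 1) → ℤ) :
    A * ∑ k, g k w + B * ∑ μ : Fin (d + 1), (2 * ∑ k, g k w - ∑ k, g k (w + e μ) - ∑ k, g k (w - e μ))
      = ∑ k, (A * g k w + B * ∑ μ : Fin (d + 1), (2 * g k w - g k (w + e μ) - g k (w - e μ))) := by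
  rw [Finset.sum_add_distrib, ← Finset.mul_sum, ← Finset.mul_sum, Finset.sum_comm]
  congr 2
  refine Finset.sum_congr rfl fun μ _ => ?_
  rw [Finset.sum_sub_distrib, Finset.sum_sub_distrib, Finset.mul_sum]

/-- ★★ **THE STENCIL EQUATION FOR THE DUAL-GRID KERNEL**: for `c ≥ 0`, `m² > 0`, all `N_μ ≥ 1` and every `w ∈ ℤ^{d+1}`,
`m²·T_N(w) + c·Σ_μ(2T_N(w) − T_N(w+e_μ) − T_N(w−e_μ)) = 1` if `N_μ ∣ w_μ` for all `μ`, `= 0` otherwise — `(c(−Δ)+m²)T_N = δ` on the torus `Π_μℤ∕N_μ`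
(plane waves are eigenfunctions; character orthogonality on the grid). [cite: King1986, (4.1), (4.4) p.670; Balaban1984PropagatorsI, (1.29) p.23] -/
theorem torusFreeKerC_green (hc : 0 ≤ c) (hm : 0 < m2) (hN : ∀ i, 1 ≤ N i) (w : Fin (d + 1) → ℤ) :
    (m2 : ℂ) * torusFreeKerC c m2 N w + (c : ℂ) * ∑ μ, (2 * torusFreeKerC c m2 N w - torusFreeKerC c m2 N (w + e μ) - torusFreeKerC c m2 N (w - e μ))
      = if (∀ i, (N i : ℤ) ∣ w i) then 1 else 0 := by
  have hN0 : (∏ i, ((N i : ℕ) : ℂ)) ≠ 0 :=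
    Finset.prod_ne_zero_iff.mpr fun i _ => by have := hN i; exact_mod_cast (show N i ≠ 0 by omega)
  simp_rw [torusFreeKerC_eq_sum_dualTerm N]
  rw [stencil_sum, Finset.sum_congr rfl fun k _ => dualTerm_stencil N hc hm k w, ← Finset.mul_sum, sum_mFourier_grid hN w]
  split_ifs with h
  · exact inv_mul_cancel₀ hN0
  · rw [mul_zero]

end Green

/-! ## §3 King's torus `Π_μ ℤ∕K_μ`: the covariance `(lapF K c m²)⁻¹` is the dual-grid kernel, hence the periodised free kernel -/

section Torus

variable (K : Fin (d + 1) → ℕ) [hK : ∀ μ, NeZero (K μ)]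

/-- The integer representative vector `(val x_μ)_μ ∈ Π_μ{0,…,K_μ−1} ⊂ ℤ^{d+1}` of a torus point. [folklore] -/
def torRepZ (x : Tor K) : Fin (d + 1) → ℤ := fun μ => ((x μ).val : ℤ)

/-- `torRepZ x` reduces to `x`. [folklore] -/
theorem intCast_torRepZ (x : Tor K) (μ : Fin (d + 1)) : ((torRepZ K x μ : ℤ) : ZMod (K μ)) = x μ := by
  simp [torRepZ]

/-- all periods are `≥ 1`. [folklore] -/
theorem one_le_period (μ : Fin (d + 1)) : 1 ≤ K μ := Nat.one_le_iff_ne_zero.mpr (NeZero.ne _)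

/-- `K_μ ∣ (torRepZ x − torRepZ y)_μ` for all `μ` iff `x = y`. [folklore] -/
theorem dvd_torRepZ_sub_iff (x y : Tor K) : (∀ μ, (K μ : ℤ) ∣ (torRepZ K x - torRepZ K y) μ) ↔ x = y := by
  constructor
  · intro h
    funext μ
    have h1 := (ZMod.intCast_eq_intCast_iff_dvd_sub _ _ (K μ)).mpr (h μ)
    rwa [intCast_torRepZ, intCast_torRepZ, eq_comm] at h1
  · rintro rfl μ
    simp

/-- `torRepZ (x + e_μ) ≡ torRepZ x + e_μ` coordinatewise `mod K`. [folklore] -/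
theorem dvd_torRepZ_add_unitVec (x : Tor K) (μ ν : Fin (d + 1)) :
    (K ν : ℤ) ∣ torRepZ K (x + unitVec K μ) ν - (torRepZ K x ν + e μ ν) := by
  rw [← ZMod.intCast_eq_intCast_iff_dvd_sub]
  push_cast
  rw [intCast_torRepZ, intCast_torRepZ, Pi.add_apply]
  congr 1
  unfold unitVec e
  rcases eq_or_ne ν μ with rfl | h
  · simp
  · simp [Pi.single_eq_of_ne h]

/-- `torRepZ (x − e_μ) ≡ torRepZ x − e_μ` coordinatewise `mod K`. [folklore] -/
theorem dvd_torRepZ_sub_unitVec (x : Tor K) (μ ν : Fin (d + 1)) :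
    (K ν : ℤ) ∣ torRepZ K (x - unitVec K μ) ν - (torRepZ K x ν - e μ ν) := by
  rw [← ZMod.intCast_eq_intCast_iff_dvd_sub]
  push_cast
  rw [intCast_torRepZ, intCast_torRepZ, Pi.sub_apply]
  congr 1
  unfold unitVec e
  rcases eq_or_ne ν μ with rfl | h
  · simp
  · simp [Pi.single_eq_of_ne h]

variable {c m2 : ℝ}

/-- The stencil shifts on the torus: `T(torRepZ(x ± e_μ) − torRepZ y) = T(torRepZ x − torRepZ y ± e_μ)`. [folklore] -/
theorem torusFreeKerC_shift (x y : Tor K) (μ : Fin (d + 1)) :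
    torusFreeKerC c m2 K (torRepZ K (x + unitVec K μ) - torRepZ K y) = torusFreeKerC c m2 K (torRepZ K x - torRepZ K y + e μ)
      ∧ torusFreeKerC c m2 K (torRepZ K (x - unitVec K μ) - torRepZ K y) = torusFreeKerC c m2 K (torRepZ K x - torRepZ K y - e μ) := by
  refine ⟨torusFreeKerC_congr K (one_le_period K) fun ν => ?_, torusFreeKerC_congr K (one_le_period K) fun ν => ?_⟩
  · rw [show (torRepZ K (x + unitVec K μ) - torRepZ K y) ν - (torRepZ K x - torRepZ K y + e μ) ν
        = torRepZ K (x + unitVec K μ) ν - (torRepZ K x ν + e μ ν) by simp only [Pi.sub_apply, Pi.add_apply]; ring]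
    exact dvd_torRepZ_add_unitVec K x μ ν
  · rw [show (torRepZ K (x - unitVec K μ) - torRepZ K y) ν - (torRepZ K x - torRepZ K y - e μ) ν
        = torRepZ K (x - unitVec K μ) ν - (torRepZ K x ν - e μ ν) by simp only [Pi.sub_apply]; ring]
    exact dvd_torRepZ_sub_unitVec K x μ ν

/-- THE COLUMN EQUATION ON KING's TORUS (complex form): for every `y`,
`m²T(x̃−ỹ) + cΣ_μ(2T(x̃−ỹ) − T((x+e_μ)~−ỹ) − T((x−e_μ)~−ỹ)) = [x = y]`. [cite: King1986, (4.4) p.670] -/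
theorem torusFreeKerC_column (hc : 0 ≤ c) (hm : 0 < m2) (x y : Tor K) :
    (m2 : ℂ) * torusFreeKerC c m2 K (torRepZ K x - torRepZ K y)
        + (c : ℂ) * ∑ μ, (2 * torusFreeKerC c m2 K (torRepZ K x - torRepZ K y)
            - torusFreeKerC c m2 K (torRepZ K (x + unitVec K μ) - torRepZ K y)
            - torusFreeKerC c m2 K (torRepZ K (x - unitVec K μ) - torRepZ K y))
      = if x = y then 1 else 0 := by
  simp_rw [(torusFreeKerC_shift K _ _ _).1, (torusFreeKerC_shift K _ _ _).2]
  rw [torusFreeKerC_green K hc hm (one_le_period K)]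
  exact if_congr (dvd_torRepZ_sub_iff K x y) rfl rfl

omit hK in
/-- King's stencil in Green form: `((c(−Δ)+m²)g)(x) = m²g(x) + cΣ_μ(2g(x) − g(x+e_μ) − g(x−e_μ))`. [cite: King1986, (4.4) p.670] -/
theorem lapF_mulVec_stencil [∀ μ, NeZero (K μ)] (c m2 : ℝ) (g : Tor K → ℝ) (x : Tor K) :
    (lapF K c m2 *ᵥ g) x = m2 * g x + c * ∑ μ, (2 * g x - g (x + unitVec K μ) - g (x - unitVec K μ)) := by
  rw [lapF_mulVec_apply, Finset.sum_sub_distrib, Finset.sum_sub_distrib, Finset.sum_add_distrib, Finset.sum_const, Finset.card_univ,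
    Fintype.card_fin]
  simp only [nsmul_eq_mul]
  push_cast
  ring

/-- The real part of the dual-grid kernel is a right inverse of King's `lapF` on the torus. [folklore] -/
theorem lapF_mul_re_torusFreeKerC (hc : 0 ≤ c) (hm : 0 < m2) :
    lapF K c m2 * (Matrix.of fun x y : Tor K => (torusFreeKerC c m2 K (torRepZ K x - torRepZ K y)).re) = 1 := by
  ext x y
  have h := congrArg Complex.re (torusFreeKerC_column K hc hm x y)
  simp only [Complex.add_re, Complex.sub_re, Complex.mul_re, Complex.ofReal_re, Complex.ofReal_im, Complex.re_ofNat, Complex.im_ofNat,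
    Complex.re_sum, zero_mul, sub_zero] at h
  have hre : (if x = y then (1 : ℂ) else 0).re = if x = y then 1 else 0 := by split_ifs <;> simp
  rw [hre] at h
  rw [Matrix.mul_apply', Matrix.one_apply, ← h]
  exact lapF_mulVec_stencil K c m2 (fun z => (torusFreeKerC c m2 K (torRepZ K z - torRepZ K y)).re) x

/-- The imaginary part of the dual-grid kernel vanishes on King's torus (it solves the homogeneous column equation). [folklore] -/
theorem im_torusFreeKerC_torRepZ (hc : 0 ≤ c) (hm : 0 < m2) (x y : Tor K) : (torusFreeKerC c m2 K (torRepZ K x - torRepZ K y)).im = 0 := by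
  have hcol : (lapF K c m2 *ᵥ fun z => (torusFreeKerC c m2 K (torRepZ K z - torRepZ K y)).im) = lapF K c m2 *ᵥ 0 := by
    funext x'
    have h := congrArg Complex.im (torusFreeKerC_column K hc hm x' y)
    simp only [Complex.add_im, Complex.sub_im, Complex.mul_im, Complex.ofReal_re, Complex.ofReal_im, Complex.re_ofNat, Complex.im_ofNat,
      Complex.im_sum, zero_mul, add_zero] at h
    have him : (if x' = y then (1 : ℂ) else 0).im = 0 := by split_ifs <;> simp
    rw [him] at h
    rw [Matrix.mulVec_zero, Pi.zero_apply, lapF_mulVec_stencil, h]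
  exact congrFun (lapF_mulVec_injective K hc hm hcol) x

/-- ★★★ **KING's TORUS COVARIANCE IN PLANE WAVES**: for every period vector `K` (all `K_μ ≥ 1`), `c ≥ 0`, `m² > 0`,
`(lapF K c m²)⁻¹(x, y) = (Π_μK_μ)⁻¹ Σ_{k ∈ Π_μℤ∕K_μ} e^{ip′_k·(x̃ − ỹ)}∕(m² + cΣ_μ(2 − 2cos p′_{k,μ}))`, `x̃ = torRepZ x` — King's (4.1)∕(4.4) plane-wave representation of the
torus covariance, in B5's (1.29) dual-grid variables. [cite: King1986, (4.1), (4.4) p.670; Balaban1984PropagatorsI, (1.29) p.23] -/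
theorem lapF_inv_eq_torusFreeKerC (hc : 0 ≤ c) (hm : 0 < m2) (x y : Tor K) :
    (((lapF K c m2)⁻¹ x y : ℝ) : ℂ) = torusFreeKerC c m2 K (torRepZ K x - torRepZ K y) := by
  rw [Matrix.inv_eq_right_inv (lapF_mul_re_torusFreeKerC K hc hm), Matrix.of_apply]
  exact Complex.ext (by simp) (by simp [im_torusFreeKerC_torRepZ K hc hm x y])

/-- ★★★ **KING's TORUS COVARIANCE IS THE PERIODISED FREE KERNEL** (complex form): `(lapF K c m²)⁻¹(x, y) = Σ_{m ∈ ℤ^{d+1}} K_∞(x̃ − ỹ + (K_μm_μ)_μ)` for every period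
vector, `c ≥ 0`, `m² > 0` — «relating G on the torus to G on the whole lattice in the usual way», for the covariance on which this lineage carries King's `A = 0`
kernels. [cite: Balaban1984PropagatorsI, p.36 l.20–23; King1986, §4 p.670 l.8–13, (4.4) p.670; Balaban1983RegularityDecay, (2.43) p.584] -/
theorem lapF_inv_eq_periodise (hc : 0 ≤ c) (hm : 0 < m2) (x y : Tor K) :
    (((lapF K c m2)⁻¹ x y : ℝ) : ℂ) = ∑' m : Fin (d + 1) → ℤ, freeKerC c m2 (translate K (torRepZ K x - torRepZ K y) m) := by
  rw [lapF_inv_eq_torusFreeKerC K hc hm, torusFreeKerC_eq_periodise K hc hm (one_le_period K)]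

/-- ★★★ **THE SAME, REAL FORM**: `(lapF K c m²)⁻¹(x, y) = Σ_{m ∈ ℤ^{d+1}} K_∞(torRepZ x − torRepZ y + (K_μm_μ)_μ)` with the real kernel `freeKer` of part Ε-a.
[cite: Balaban1984PropagatorsI, p.36 l.20–23; King1986, §4 p.670 l.8–13; Balaban1983RegularityDecay, (2.42)–(2.43) p.584] -/
theorem lapF_inv_eq_tsum_freeKer (hc : 0 ≤ c) (hm : 0 < m2) (x y : Tor K) :
    (lapF K c m2)⁻¹ x y = ∑' m : Fin (d + 1) → ℤ, freeKer c m2 (translate K (torRepZ K x - torRepZ K y) m) := by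
  apply Complex.ofReal_injective
  rw [lapF_inv_eq_periodise K hc hm, Complex.ofReal_tsum]
  exact tsum_congr fun m => (ofReal_freeKer c m2 _).symm

/-- summability of the periodised real kernel along every class. [folklore] -/
theorem summable_freeKer_translate (hc : 0 ≤ c) (hm : 0 < m2) (w : Fin (d + 1) → ℤ) :
    Summable fun m : Fin (d + 1) → ℤ => freeKer c m2 (translate K w m) := by
  have hinj : Function.Injective (translate K w) :=
    Literature.MathematicalPhysics.QuantumFieldTheory.Balaban1983to89.B4TorusKernel.MultiPeriod.translate_injective (one_le_period K) w
  exact (summable_freeKer hc hm).comp_injective hinj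

end Torus

/-! ## §4 Corollary: the total mass of the free kernel -/

section Mass

/-- ★★ **`Σ_{z ∈ ℤ^{d+1}} K_∞(z) = 1∕m²`** — read off the one-point torus `K = 1`: there every neighbour of the point is the point, `c(−Δ) = 0`,
`lapF 1 c m² = (m²)` as a `1 × 1` matrix, and the periodisation over `ℤ^{d+1}·1` is the full lattice sum (the zero-momentum value of the multiplier).
[cite: King1986, (4.4) p.670; Balaban1983RegularityDecay, (2.43) p.584] -/
theorem tsum_freeKer_eq_inv_mass {c m2 : ℝ} (hc : 0 ≤ c) (hm : 0 < m2) : ∑' z : Fin (d + 1) → ℤ, freeKer c m2 z = m2⁻¹ := by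
  have h := lapF_inv_eq_tsum_freeKer (fun _ : Fin (d + 1) => 1) hc hm 0 0
  have hT : ∀ m : Fin (d + 1) → ℤ, translate (fun _ : Fin (d + 1) => 1) (torRepZ (fun _ => 1) 0 - torRepZ (fun _ => 1) 0) m = m := by
    intro m; funext i; simp
  simp_rw [hT] at h
  rw [← h]
  -- the `1 × 1` matrix `lapF 1 c m²` has the single entry `m²`
  have h00 : lapF (fun _ : Fin (d + 1) => 1) c m2 0 0 = m2 := by
    simp only [lapF, eq_iff_true_of_subsingleton, if_true, Finset.sum_const, Finset.card_univ, Fintype.card_fin, nsmul_eq_mul]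
    push_cast
    ring
  have hunit : IsUnit (lapF (fun _ : Fin (d + 1) => 1) c m2).det := (Matrix.isUnit_iff_isUnit_det _).mp (isUnit_lapF _ hc hm)
  have hmul := congrFun (congrFun (Matrix.mul_nonsing_inv _ hunit) 0) 0
  rw [Matrix.mul_apply, Finset.sum_eq_single (0 : Tor fun _ : Fin (d + 1) => 1) (fun b _ hb => absurd (Subsingleton.elim b 0) hb)
    (fun h0 => absurd (Finset.mem_univ _) h0), Matrix.one_apply_eq, h00] at hmul
  exact eq_inv_of_mul_eq_one_right hmul

end Mass

end Summit.QuantumFields.YangMills.BalabanUVNodes.N15KingModelRung.TorusSpectral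

end
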